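import Summits.KontsevichZagierPeriods.KontsevichZagierPeriods.Theorems.SpheresForWallsOneConicLayerKit
import Summits.KontsevichZagierPeriods.KontsevichZagierPeriods.Theorems.SpheresForWallsWallFreeExactness
import Summits.KontsevichZagierPeriods.KontsevichZagierPeriods.Theorems.InverseLandauTateLiftingRotationSector
import Summits.KontsevichZagierPeriods.KontsevichZagierPeriods.Theorems.InverseLandauTateLiftingDimOneSector

/-!
# `OneConicLayer` (stmt-KontsevichZagierPeriods-16402, route SpheresForWalls) — proof

THE SIMPLEST CLOSED VARIETY HAS `N = 0`. A spherical representation `R = [ℝ², p(w)/(1+|w|²)ᵏ]`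
(`p ∈ ℚ[w₀, w₁]`, domain all of `ℝ²`, density analytic at every point and at the point at infinity
of the sphere, i.e. after the inversion `w ↦ w/|w|²`) with value `0` is a relation of the
Kontsevich–Zagier calculus. Proof — no primitive of the integrand is ever taken:

1. WEIGHTS. Continuity of the inverted density at the pole forces `deg p ≤ 2k − 4`
   (`OneConic.degree_add_four_le`), so every piece below is absolutely integrable
   (`OneConic.integrable_aeval_div`).
2. HARMONIC DECOMPOSITION `p = P(w₀² + w₁²) + (w₀∂₁ − w₁∂₀)H`, `P ∈ ℚ[T]`, `deg H ≤ deg p`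
   (`OneConic.decomp`), and `(w₀∂₁ − w₁∂₀)H · ρₖ = ∂₁(w₀Hρₖ) − ∂₀(w₁Hρₖ)` for `ρₖ = (1+|w|²)⁻ᵏ`
   (the angular vector field is tangent to the level circles of `ρₖ`).
3. EXACTNESS IS A MOVE. `[ℝ², ∂₁(w₀Hρₖ)] ∈ KZ.relations` by the landed `WallFreeExactness`
   (rational potential `w₀Hρₖ → 0` along every vertical line), and the `∂₀`-piece is the
   coordinate swap (`KZ.of_sub_of_reindex_mem_relations`) of the same statement for `−H(w₁, w₀)`
   (`OneConic.exact_piece`).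
4. THE RADIAL PART `[ℝ², P(|w|²)ρₖ]` has value `0` (soundness) and is rotation invariant: the
   rotation engine `rotation_reduce` turns it into `[meridian]·[disc]` with the RATIONAL meridian
   `[(0,∞), 2ρP(ρ²)/(1+ρ²)ᵏ]` of value `0`, a relation by the dimension-one rational kernel theorem
   `tateLifting_dimOneRationalSector` (Baker inside the calculus); `relations` is an ideal
   (`OneConic.radial_mem_relations`).

References: M. Kontsevich, D. Zagier, *Periods* (2001), §1.2, §4.1; A. Grothendieck, On the de Rham
cohomology of algebraic varieties, Publ. IHÉS 29 (1966) (exactness with rational potentials).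
-/

noncomputable section

open MeasureTheory Set Filter Topology
open MvPolynomial
open Literature.NumberTheory.Transcendental
open Literature.ModelTheory.ExponentialFields (IsSemialgebraic isSemialgebraic_univ)

namespace Summit.KontsevichZagierPeriods.SpheresForWalls

namespace OneConic

/-! ### Exact pieces -/

/-- Decay of the potential `c·g(s)/(1 + c² + s²)ᵏ` along a line on which `s² → ∞`, when
`|g(s)| ≤ M √(1 + c² + s²)ᵈ` with `d < 2k`. [folklore] -/
theorem tendsto_potential {l : Filter ℝ} (hl : Tendsto (fun s : ℝ => s ^ 2) l atTop) (c : ℝ) {M : ℝ}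
    (hM : 0 ≤ M) (d k : ℕ) (hd : d + 1 ≤ 2 * k) (g : ℝ → ℝ)
    (hg : ∀ s, |g s| ≤ M * Real.sqrt (1 + (c ^ 2 + s ^ 2)) ^ d) :
    Tendsto (fun s => c * g s / (1 + (c ^ 2 + s ^ 2)) ^ k) l (𝓝 0) := by
  have hB : Tendsto (fun s : ℝ => Real.sqrt (1 + (c ^ 2 + s ^ 2))) l atTop :=
    Real.tendsto_sqrt_atTop.comp
      (tendsto_atTop_add_const_left _ _ (tendsto_atTop_add_const_left _ _ hl))
  have hb : Tendsto (fun s => |c| * M * (Real.sqrt (1 + (c ^ 2 + s ^ 2)))⁻¹) l (𝓝 0) := by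
    simpa using hB.inv_tendsto_atTop.const_mul (|c| * M)
  refine squeeze_zero_norm' (Eventually.of_forall fun s => ?_) hb
  set B : ℝ := 1 + (c ^ 2 + s ^ 2)
  have hB0 : 0 < B := by positivity
  have hS1 : 1 ≤ Real.sqrt B := by
    rw [Real.one_le_sqrt]; show 1 ≤ 1 + (c ^ 2 + s ^ 2); nlinarith [sq_nonneg c, sq_nonneg s]
  have hS0 : 0 < Real.sqrt B := by positivity
  rw [Real.norm_eq_abs, abs_div, abs_mul, abs_of_pos (pow_pos hB0 k), div_le_iff₀ (pow_pos hB0 k),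
    show B ^ k = Real.sqrt B ^ (2 * k) by rw [pow_mul, Real.sq_sqrt hB0.le]]
  calc |c| * |g s| ≤ |c| * (M * Real.sqrt B ^ d) := by gcongr; exact hg s
    _ ≤ |c| * (M * Real.sqrt B ^ (2 * k - 1)) :=
        mul_le_mul_of_nonneg_left (mul_le_mul_of_nonneg_left (pow_le_pow_right₀ hS1 (by omega)) hM)
          (abs_nonneg c)
    _ = |c| * M * (Real.sqrt B)⁻¹ * Real.sqrt B ^ (2 * k) := by
        have h3 : Real.sqrt B ^ (2 * k) = Real.sqrt B * Real.sqrt B ^ (2 * k - 1) := by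
          rw [← pow_succ']; congr 1; omega
        rw [h3, mul_assoc (|c| * M), inv_mul_cancel_left₀ hS0.ne', mul_assoc]

/-- **Exact pieces are relations.** For `G ∈ ℚ[w₀, w₁]` with `deg G ≤ 2k − 4`, the honest
representation `E = [ℝ², ∂₁(w₀ G ρₖ)]`, `ρₖ = (1 + w₀² + w₁²)⁻ᵏ`, i.e. with integrand
`(w₀ ∂₁G (1+|w|²) − 2k w₀w₁ G)/(1+|w|²)ᵏ⁺¹`, exists and `[E] ∈ KZ.relations`: one instance of the
landed `WallFreeExactness` with the rational potential `A = w₀ G ρₖ`, which tends to `0` along every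
vertical line since `deg(w₀G) < 2k`. [cite: KontsevichZagier2001, §1.2 rule (3)] -/
theorem exact_piece (k : ℕ) (G : MvPolynomial (Fin 2) ℚ) (hG : G.totalDegree + 4 ≤ 2 * k) :
    ∃ E : KZ.IntegralRep 2, E.domain = univ ∧
      (E.integrand = fun w : Fin 2 → ℝ => (w 0 * aeval w (pderiv 1 G) * (1 + (w 0 ^ 2 + w 1 ^ 2)) -
          2 * (k : ℝ) * w 0 * w 1 * aeval w G) / (1 + (w 0 ^ 2 + w 1 ^ 2)) ^ (k + 1)) ∧
      KZ.of E ∈ KZ.relations := by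
  obtain ⟨k, rfl⟩ : ∃ k', k = k' + 1 := ⟨k - 1, by omega⟩
  set Q : MvPolynomial (Fin 2) ℚ := 1 + (X 0 ^ 2 + X 1 ^ 2) with hQ
  set Pn : MvPolynomial (Fin 2) ℚ :=
    X 0 * pderiv 1 G * Q - C (2 * (k + 1 : ℕ) : ℚ) * X 0 * X 1 * G with hPn
  have hQw : ∀ w : Fin 2 → ℝ, aeval w Q = 1 + (w 0 ^ 2 + w 1 ^ 2) := fun w => by simp [hQ]
  have hQ0 : ∀ w : Fin 2 → ℝ, (0 : ℝ) < 1 + (w 0 ^ 2 + w 1 ^ 2) := fun w => by positivity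
  set e : (Fin 2 → ℝ) → ℝ := fun w => (w 0 * aeval w (pderiv 1 G) * (1 + (w 0 ^ 2 + w 1 ^ 2)) -
      2 * ((k + 1 : ℕ) : ℝ) * w 0 * w 1 * aeval w G) / (1 + (w 0 ^ 2 + w 1 ^ 2)) ^ (k + 1 + 1)
    with he
  have hePQ : ∀ w, aeval w Pn / (1 + (w 0 ^ 2 + w 1 ^ 2)) ^ (k + 1 + 1) = e w := fun w => by
    simp only [he, hPn, map_sub, map_mul, aeval_X, hQw, map_natCast, MvPolynomial.aeval_C,
      eq_ratCast, Rat.cast_ofNat]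
  have hsa : IsSemialgebraicFunOn ℚ univ e :=
    (isSemialgebraicFunOn_aeval_div_aeval isSemialgebraic_univ Pn (Q ^ (k + 1 + 1))
      (fun w _ => by rw [map_pow, hQw]; positivity)).congr fun w _ => by
        show aeval w Pn / aeval w (Q ^ (k + 1 + 1)) = e w
        rw [map_pow, hQw, hePQ]
  have hdeg : Pn.totalDegree + 3 ≤ 2 * (k + 1 + 1) := by
    have h1 : Pn.totalDegree ≤ _ :=
      totalDegree_sub (X 0 * pderiv 1 G * Q) (C (2 * (k + 1 : ℕ) : ℚ) * X 0 * X 1 * G)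
    have h2 := totalDegree_mul (X 0 * pderiv 1 G) Q
    have h3 := totalDegree_mul (X 0 : MvPolynomial (Fin 2) ℚ) (pderiv 1 G)
    have h4 := totalDegree_pderiv_le 1 G
    have h5 : Q.totalDegree ≤ 2 := (totalDegree_add _ _).trans (max_le (by simp)
      ((totalDegree_add _ _).trans (max_le (totalDegree_X_pow _ _).le (totalDegree_X_pow _ _).le)))
    have h6 := totalDegree_mul (C (2 * (k + 1 : ℕ) : ℚ) * X 0 * X 1) G
    have h7 := totalDegree_mul (C (2 * (k + 1 : ℕ) : ℚ) * X 0) (X 1 : MvPolynomial (Fin 2) ℚ)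
    have h8 := totalDegree_mul (C (2 * (k + 1 : ℕ) : ℚ)) (X 0 : MvPolynomial (Fin 2) ℚ)
    rw [totalDegree_X] at h3 h7 h8
    rw [totalDegree_C] at h8
    omega
  have hint : Integrable e :=
    (integrable_aeval_div Pn (k + 1 + 1) hdeg).congr (ae_of_all _ fun w => hePQ w)
  let E : KZ.IntegralRep 2 := ⟨univ, e, isSemialgebraic_univ, hsa, hint.integrableOn⟩
  refine ⟨E, rfl, rfl, ?_⟩
  -- the potential `A = w₀ G ρₖ`
  obtain ⟨M, hM0, hM⟩ := abs_aeval_le_sqrt_pow G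
  set A : (Fin 2 → ℝ) → ℝ := fun w => w 0 * aeval w G / (1 + (w 0 ^ 2 + w 1 ^ 2)) ^ (k + 1)
    with hA
  have hAsa : IsSemialgebraicFunOn ℚ univ A :=
    (isSemialgebraicFunOn_aeval_div_aeval isSemialgebraic_univ (X 0 * G) (Q ^ (k + 1))
      (fun w _ => by rw [map_pow, hQw]; positivity)).congr fun w _ => by
        simp only [hA, map_mul, map_pow, aeval_X, hQw]
  have h0 : ∀ (x : Fin 1 → ℝ) (s : ℝ), (Fin.snoc x s : Fin 2 → ℝ) 0 = x 0 := fun _ _ => rfl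
  have h1 : ∀ (x : Fin 1 → ℝ) (s : ℝ), (Fin.snoc x s : Fin 2 → ℝ) 1 = s := fun _ _ => rfl
  have hAx : ∀ x : Fin 1 → ℝ, (fun s : ℝ => A (Fin.snoc x s)) = fun s =>
      x 0 * aeval (Fin.snoc x s : Fin 2 → ℝ) G / (1 + (x 0 ^ 2 + s ^ 2)) ^ (k + 1) := fun x => by
    funext s; simp only [hA, h0, h1]
  have hdecay : ∀ (x : Fin 1 → ℝ) {l : Filter ℝ}, Tendsto (fun s : ℝ => s ^ 2) l atTop →
      Tendsto (fun s : ℝ => A (Fin.snoc x s)) l (𝓝 0) := fun x l hl => by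
    rw [hAx]
    refine tendsto_potential hl (x 0) hM0 G.totalDegree (k + 1) (by omega) _ fun s => ?_
    simpa only [h0, h1] using hM (Fin.snoc x s)
  refine wallFreeExactness_proof 1 E A rfl hAsa (fun x t => ?_)
    (fun x => hdecay x (tendsto_pow_atTop two_ne_zero)) fun x => hdecay x ?_
  · -- `∂ₛ A(x₀, s) = e(x₀, s)`
    have hγ : ∀ i : Fin 2, HasDerivAt (fun u : ℝ => (Fin.snoc x u : Fin 2 → ℝ) i)
        ((![0, 1] : Fin 2 → ℝ) i) t := by
      intro i
      fin_cases i
      · simpa [h0] using hasDerivAt_const t (x 0)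
      · simpa [h1] using hasDerivAt_id' t
    have hG' := KZ.hasDerivAt_aeval_comp_real hγ G
    simp only [Fin.sum_univ_two, Matrix.cons_val_zero, Matrix.cons_val_one, mul_zero, zero_add,
      mul_one] at hG'
    have hD : HasDerivAt (fun s : ℝ => 1 + (x 0 ^ 2 + s ^ 2)) (2 * t) t := by
      simpa using ((hasDerivAt_pow 2 t).const_add (x 0 ^ 2)).const_add 1
    have hA' := (hG'.const_mul (x 0)).div (hD.pow (k + 1))
      (by simp only [Pi.pow_apply]; positivity)
    have hfun : (fun s : ℝ => A (Fin.snoc x s)) =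
        (fun y : ℝ => x 0 * aeval (Fin.snoc x y : Fin 2 → ℝ) G) /
          (fun s : ℝ => 1 + (x 0 ^ 2 + s ^ 2)) ^ (k + 1) := by
      rw [hAx]; funext s; simp only [Pi.div_apply, Pi.pow_apply]
    rw [hfun]
    refine hA'.congr_deriv ?_
    show _ = e (Fin.snoc x t)
    simp only [he, h0, h1, Pi.pow_apply, Nat.cast_add, Nat.cast_one, add_tsub_cancel_right]
    field_simp
    ring
  · -- `s² → ∞` as `s → −∞`
    refine ((tendsto_pow_atTop two_ne_zero).comp tendsto_abs_atBot_atTop).congr fun s => ?_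
    simp [sq_abs]

/-! ### The radial part -/

/-- **The radial part is a relation.** A representation `[ℝ², P(w₀²+w₁²)/(1+w₀²+w₁²)ᵏ]`
(`P ∈ ℚ[T]`) of value `0` lies in `KZ.relations`: it is rotation invariant, so the rotation engine
(`rotation_reduce`) makes it congruent to `[m]·[disc]` with the honest meridian
`m = [(0, ∞), 2ρ P(ρ²)/(1+ρ²)ᵏ]`, a KZ-RATIONAL representation of dimension one whose value is `0`
(soundness, `π ≠ 0`); `[m] ∈ relations` by the dimension-one rational kernel theorem
(`tateLifting_dimOneRationalSector`), and `relations` is a right ideal.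
[cite: KontsevichZagier2001, §1.2] -/
theorem radial_mem_relations (k : ℕ) (P : Polynomial ℚ) (Rd : KZ.IntegralRep 2)
    (hd : Rd.domain = univ)
    (hi : Rd.integrand = fun w => Polynomial.aeval (w 0 ^ 2 + w 1 ^ 2) P /
      (1 + (w 0 ^ 2 + w 1 ^ 2)) ^ k)
    (hev : KZ.eval (KZ.of Rd) = 0) : KZ.of Rd ∈ KZ.relations := by
  -- rotation invariance and the meridian
  obtain ⟨m, hmd, hmi, hred⟩ := Summit.KontsevichZagierPeriods.InverseLandau.rotation_reduce
    (n := 0) Rd fun x _ c s hcs => by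
      refine ⟨by rw [hd]; trivial, ?_⟩
      have key : (c * x 0 - s * x 1) ^ 2 + (s * x 0 + c * x 1) ^ 2 = x 0 ^ 2 + x 1 ^ 2 := by
        linear_combination (x 0 ^ 2 + x 1 ^ 2) * hcs
      rw [hi]
      show Polynomial.aeval ((c * x 0 - s * x 1) ^ 2 + (s * x 0 + c * x 1) ^ 2) P /
          (1 + ((c * x 0 - s * x 1) ^ 2 + (s * x 0 + c * x 1) ^ 2)) ^ k =
        Polynomial.aeval (x 0 ^ 2 + x 1 ^ 2) P / (1 + (x 0 ^ 2 + x 1 ^ 2)) ^ k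
      rw [key]
  -- the meridian has value `0`
  have hevm : KZ.eval (KZ.of m) = 0 := by
    have h0 := KZ.relations_le_ker_eval_holds hred
    rw [AddMonoidHom.mem_ker, map_sub, KZ.eval_mul', KZ.eval_of_piRep, hev, zero_sub, neg_eq_zero]
      at h0
    exact (mul_eq_zero.1 h0).resolve_right Real.pi_ne_zero
  -- the meridian is KZ-rational
  have hrat : m.IsRational := by
    refine ⟨C 2 * X 0 * Polynomial.aeval (X 0 ^ 2 : MvPolynomial (Fin 1) ℚ) P, (1 + X 0 ^ 2) ^ k,
      fun x _ => by simp only [map_pow, map_add, map_one, aeval_X]; positivity, fun x _ => ?_⟩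
    rw [hmi, hi]
    have e0 : (Fin.snoc x 0 : Fin 2 → ℝ) 0 = x 0 := rfl
    have e1 : (Fin.snoc x 0 : Fin 2 → ℝ) 1 = 0 := rfl
    simp only [Fin.last_zero, e0, e1, map_mul, map_pow, map_add, map_one, aeval_X,
      MvPolynomial.aeval_C, ← Polynomial.aeval_algHom_apply, eq_ratCast, Rat.cast_ofNat]
    ring_nf
  have hm : KZ.of m ∈ KZ.relations := by
    have h := Summit.KontsevichZagierPeriods.InverseLandau.tateLifting_dimOneRationalSector 1
      (fun _ => 1) (fun _ => m) (fun _ => hrat) (by simpa using hevm)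
    simpa using h
  have hsum : KZ.of Rd = (KZ.of Rd - KZ.of m * KZ.of KZ.piRep) + KZ.of m * KZ.of KZ.piRep := by abel
  rw [hsum]
  exact add_mem hred (KZ.mul_mem_relations_right_holds _ _ hm)

end OneConic

open OneConic

/-- **`OneConicLayer`** (route SpheresForWalls, stmt-KontsevichZagierPeriods-16402): a spherical
representation of dimension `2` with density `p(w)/(1+|w|²)ᵏ`, `p ∈ ℚ[w₀, w₁]`, and value `0` is a
relation of the Kontsevich–Zagier calculus. Analyticity at the point at infinity bounds the weights
(`deg p ≤ 2k − 4`); the harmonic decomposition `p = P(|w|²) + (w₀∂₁ − w₁∂₀)H` splits the density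
into two exact pieces with rational potentials (relations by `WallFreeExactness`, one after a
coordinate swap) and a rotation-invariant piece of value `0`, which the rotation engine and the
dimension-one rational kernel theorem put in `KZ.relations`. [cite: KontsevichZagier2001, §1.2] -/
theorem oneConicLayer_proof :
    Summit.KontsevichZagierPeriods.KontsevichZagierPeriods.Theses.SpheresForWalls.OneConicLayer := by
  intro R p k hS hint hev
  obtain ⟨hdom, hK⟩ := hS
  obtain ⟨K, hKan, hK⟩ := hK (fun _ => true)
  have f0 : ∀ j : Fin 1, (finProdFinEquiv (j, (0 : Fin 2)) : Fin (1 * 2)) = (0 : Fin 2) :=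
    fun j => by fin_cases j; rfl
  have f1 : ∀ j : Fin 1, (finProdFinEquiv (j, (1 : Fin 2)) : Fin (1 * 2)) = (1 : Fin 2) :=
    fun j => by fin_cases j; rfl
  simp only [f0, f1, if_true] at hK
  have hint' : R.integrand = fun w : Fin 2 → ℝ => aeval w p / (1 + (w 0 ^ 2 + w 1 ^ 2)) ^ k := by
    rw [hint]; rfl
  -- the inverted chart: `K(y/|y|²) = p(y)/(1+|y|²)ᵏ · |y|⁴`
  have hKinv : ∀ y : Fin 2 → ℝ, y 0 ^ 2 + y 1 ^ 2 ≠ 0 → K (fun i => y i / (y 0 ^ 2 + y 1 ^ 2)) =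
      aeval y p / (1 + (y 0 ^ 2 + y 1 ^ 2)) ^ k * (y 0 ^ 2 + y 1 ^ 2) ^ 2 := by
    intro y hy
    obtain ⟨h1, h2⟩ := inversion_inv y hy
    have hne : (y 0 / (y 0 ^ 2 + y 1 ^ 2)) ^ 2 + (y 1 / (y 0 ^ 2 + y 1 ^ 2)) ^ 2 ≠ 0 := by
      rw [h1]; exact inv_ne_zero hy
    have h := hK (fun i => y i / (y 0 ^ 2 + y 1 ^ 2)) (fun _ _ => hne)
    simp only [h2] at h
    simpa only [hint', h1, inv_pow, inv_inv, Fin.prod_univ_one] using h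
  -- trivial case `p = 0`
  by_cases hp0 : p = 0
  · exact KZ.of_mem_relations_of_eqOn_zero R fun w _ => by simp [hint', hp0]
  -- weights: `deg p ≤ 2k - 4`
  have hdeg : p.totalDegree + 4 ≤ 2 * k := by
    have hsupp := degree_add_four_le p k K
      (continuous_iff_continuousAt.2 fun x => (hKan x).continuousAt) hKinv
    obtain ⟨dm, hdm, hdeg⟩ := Finset.exists_mem_eq_sup p.support
      (Finset.nonempty_iff_ne_empty.2 (by rwa [Ne, MvPolynomial.support_eq_empty]))
      fun s => s.sum fun _ e => e
    rw [MvPolynomial.totalDegree, hdeg, Finsupp.sum_fintype _ _ (fun _ => rfl), Fin.sum_univ_two]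
    exact hsupp dm hdm
  -- harmonic decomposition and the two exact pieces
  obtain ⟨P, H, hpH, hHdeg⟩ := decomp p
  set σ : Equiv.Perm (Fin 2) := Equiv.swap (0 : Fin 2) 1 with hσ
  set Gs : MvPolynomial (Fin 2) ℚ := -(rename σ H) with hGs
  have hGs4 : Gs.totalDegree + 4 ≤ 2 * k := by
    have := totalDegree_rename_le σ H
    rw [hGs, totalDegree_neg]
    omega
  obtain ⟨E₁, hE₁d, hE₁i, hE₁⟩ := exact_piece k H (by omega)
  obtain ⟨E, hEd, hEi, hE⟩ := exact_piece k Gs hGs4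
  set E₀ := E.reindex σ with hE₀
  have hE₀r : KZ.of E₀ ∈ KZ.relations := by
    have h := sub_mem hE (KZ.of_sub_of_reindex_mem_relations E σ)
    rwa [sub_sub_cancel] at h
  have hE₀d : E₀.domain = univ := by
    rw [hE₀, KZ.IntegralRep.reindex_domain, hEd]
    exact eq_univ_of_forall fun _ => mem_univ _
  -- the pointwise splitting `f = P(|w|²)ρₖ + e₀ + e₁`
  have hsw : ∀ w : Fin 2 → ℝ, aeval (fun i => w (σ i)) Gs = -aeval w H ∧
      aeval (fun i => w (σ i)) (pderiv 1 Gs) = -aeval w (pderiv 0 H) := by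
    intro w
    have hcomp : ((fun i => w (σ i)) ∘ σ) = w := by
      funext i; simp [hσ, Equiv.swap_apply_self]
    have hpd : pderiv 1 (rename σ H) = rename σ (pderiv 0 H) := by
      have h := pderiv_rename σ.injective 0 H
      rwa [hσ, Equiv.swap_apply_left] at h
    refine ⟨?_, ?_⟩
    · rw [hGs, map_neg, aeval_rename, hcomp]
    · rw [hGs, map_neg, map_neg, hpd, aeval_rename, hcomp]
  set radf : (Fin 2 → ℝ) → ℝ := fun w => Polynomial.aeval (w 0 ^ 2 + w 1 ^ 2) P /
    (1 + (w 0 ^ 2 + w 1 ^ 2)) ^ k with hradf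
  have hpt : ∀ w, R.integrand w = radf w + (E₀.integrand w + E₁.integrand w) := by
    intro w
    have hD : (1 + (w 0 ^ 2 + w 1 ^ 2) : ℝ) ≠ 0 := by positivity
    have ep : aeval w p = Polynomial.aeval (w 0 ^ 2 + w 1 ^ 2) P +
        (w 0 * aeval w (pderiv 1 H) - w 1 * aeval w (pderiv 0 H)) := by
      have h := congrArg (aeval w) hpH
      rw [map_add, ← Polynomial.aeval_algHom_apply] at h
      simpa using h
    obtain ⟨s1, s2⟩ := hsw w
    rw [hint', hE₀, KZ.IntegralRep.reindex_integrand, hEi, hE₁i]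
    simp only [hradf, s1, s2]
    simp only [hσ, Equiv.swap_apply_left, Equiv.swap_apply_right]
    rw [ep]
    field_simp
    ring
  -- the radial representation (honest: integrable as a difference of integrable functions)
  have hRadInt : Integrable radf := by
    have hR := R.integrableOn
    have h0 := E₀.integrableOn
    have h1 := E₁.integrableOn
    rw [hdom, integrableOn_univ] at hR
    rw [hE₀d, integrableOn_univ] at h0
    rw [hE₁d, integrableOn_univ] at h1
    have : radf = fun w => R.integrand w - (E₀.integrand w + E₁.integrand w) :=
      funext fun w => by rw [hpt w]; ring
    rw [this]
    exact hR.sub (h0.add h1)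
  have hRadSA : IsSemialgebraicFunOn ℚ univ radf :=
    (isSemialgebraicFunOn_aeval_div_aeval isSemialgebraic_univ
      (Polynomial.aeval (X 0 ^ 2 + X 1 ^ 2 : MvPolynomial (Fin 2) ℚ) P)
      ((1 + (X 0 ^ 2 + X 1 ^ 2)) ^ k)
      (fun w _ => by simp only [map_pow, map_add, map_one, aeval_X]; positivity)).congr
      fun w _ => by
        simp only [hradf, map_pow, map_add, map_one, aeval_X, ← Polynomial.aeval_algHom_apply]
  let Rad : KZ.IntegralRep 2 := ⟨univ, radf, isSemialgebraic_univ, hRadSA, hRadInt.integrableOn⟩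
  -- `[R] = [Rad] + [E₀] + [E₁]` modulo relations, so `[Rad]` has value `0`
  have h3 := KZ.of_sub_of_sub_sum_mem_relations 2 R Rad ![E₀, E₁] (by rw [hdom])
    (fun i => by fin_cases i <;> simp [hE₀d, hE₁d, hdom]) fun w _ => by
      simpa [Fin.sum_univ_two] using hpt w
  have hevRad : KZ.eval (KZ.of Rad) = 0 := by
    have h := KZ.relations_le_ker_eval_holds h3
    have e0 := KZ.relations_le_ker_eval_holds hE₀r
    have e1 := KZ.relations_le_ker_eval_holds hE₁
    rw [AddMonoidHom.mem_ker] at h e0 e1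
    rw [map_sub, map_sub, map_sum, hev, Fin.sum_univ_two] at h
    simp only [Matrix.cons_val_zero, Matrix.cons_val_one] at h
    linarith
  have hRad := radial_mem_relations k P Rad rfl rfl hevRad
  have hsum : KZ.of R = (KZ.of R - KZ.of Rad - ∑ i : Fin 2, KZ.of ((![E₀, E₁] :
      Fin 2 → KZ.IntegralRep 2) i)) + KZ.of Rad + (KZ.of E₀ + KZ.of E₁) := by
    rw [Fin.sum_univ_two]
    simp only [Matrix.cons_val_zero, Matrix.cons_val_one]
    abel
  rw [hsum]
  exact add_mem (add_mem h3 hRad) (add_mem hE₀r hE₁)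

end Summit.KontsevichZagierPeriods.SpheresForWalls

end
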